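import Literature.Analysis.Matrix.FiniteRangeDecomposition
import Literature.Analysis.Fourier.ConvolutionOperatorSymbol
import HarnessLib

/-!
# Finite-range decomposition: symbols and kernel bounds for convolution operators

For a translation-invariant symmetric matrix `A` on a finite abelian group `G` with `0 ≤ A ≤ 4`
(Loewner), the pieces `C_N = frdPiece A N` and remainders `R_J = frdRemainder A J` of the dyadic Fejér
finite-range decomposition (`Literature/Analysis/Matrix/FiniteRangeDecomposition.lean`) are
translation-invariant convolution operators whose symbols at a character `ψ` with `σ_A(ψ) = a ∈ [0,4]`,
`a = 4 sin²(πx)`, `x ∈ [0, 1/2]`, are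

  `σ_{C_N}(ψ) = ¼ F_{2^N−1}(x)²`  and  `σ_{R_J}(ψ) = F_{2^J−1}(x)/2^J`

(`symbol_frdPiece_re`, `symbol_frdRemainder_re`), whence the single-shell bounds

  `0 ≤ σ_{C_N} ≤ 4^{N−1}`,  `σ_{C_N} · a² ≤ π⁴/4^{N+1}`,  `0 ≤ σ_{R_J} ≤ 1`,  `σ_{R_J} · a ≤ π²/4^J`

(`symbol_frdPiece_re_le`, `symbol_frdPiece_re_mul_sq_le`, `symbol_frdRemainder_re_le_one`,
`symbol_frdRemainder_re_mul_le`) and the kernel bound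
`|C_N(x,y)| ≤ |G|⁻¹ Σ_ψ σ_{C_N}(ψ)` (`abs_frdPiece_apply_le`).  With `a(ψ) ≥ c₀ ε(ψ)` for the
nearest-neighbour Laplacian symbol `ε` on a `d = 3` torus the right-hand side is `O(2^{−N})`
uniformly in the volume (one momentum shell `|k| ∼ 2^{−N}`), the scaling of
[cite: BrydgesGuadagniMitter2004, Thm. 1.1] / [cite: Bauerschmidt2013, Thm. 1.2 (ii)].
-/

noncomputable section

open Finset Polynomial Real
open Literature.Analysis.Fourier Literature.Analysis.Fourier.TrigApprox

namespace Literature.Analysis.Matrix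

variable {G : Type*} [AddCommGroup G] [Fintype G] [DecidableEq G]
variable {A : _root_.Matrix G G ℝ} (ψ : AddChar G ℂ)

/-! ## The angle variable `x(a)` with `4 sin²(πx) = a` -/

/-- For `a ∈ [0,4]`: the angle `x(a) := arcsin(√a/2)/π ∈ [0, 1/2]` with `4 sin²(π x(a)) = a`. [folklore] -/
def frdAngle (a : ℝ) : ℝ := Real.arcsin (Real.sqrt a / 2) / π

/-- `4 sin²(π x(a)) = a` for `0 ≤ a ≤ 4`. [folklore] -/
theorem four_mul_sin_sq_frdAngle {a : ℝ} (ha0 : 0 ≤ a) (ha4 : a ≤ 4) :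
    4 * Real.sin (π * frdAngle a) ^ 2 = a := by
  unfold frdAngle
  rw [mul_div_cancel₀ _ Real.pi_ne_zero, Real.sin_arcsin]
  · rw [div_pow, Real.sq_sqrt ha0]; ring
  · have : 0 ≤ Real.sqrt a := Real.sqrt_nonneg a
    linarith
  · have h4 : Real.sqrt a ≤ 2 := by
      rw [show (2 : ℝ) = Real.sqrt 4 by rw [show (4 : ℝ) = 2 ^ 2 by norm_num, Real.sqrt_sq (by norm_num)]]
      exact Real.sqrt_le_sqrt ha4
    linarith

/-- `cos(2π x(a)) = 1 − a/2` for `0 ≤ a ≤ 4`. [folklore] -/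
theorem cos_two_pi_frdAngle {a : ℝ} (ha0 : 0 ≤ a) (ha4 : a ≤ 4) :
    Real.cos (2 * π * frdAngle a) = 1 - a / 2 := by
  have h := four_mul_sin_sq_frdAngle ha0 ha4
  rw [show 2 * π * frdAngle a = 2 * (π * frdAngle a) by ring, Real.cos_two_mul, Real.cos_sq']
  linarith

/-- `0 ≤ x(a)`. [folklore] -/
theorem frdAngle_nonneg (a : ℝ) : 0 ≤ frdAngle a := by
  unfold frdAngle
  exact div_nonneg (Real.arcsin_nonneg.mpr (by positivity)) Real.pi_pos.le

/-- `x(a) ≤ 1/2`. [folklore] -/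
theorem frdAngle_le_half (a : ℝ) : frdAngle a ≤ 1 / 2 := by
  unfold frdAngle
  rw [div_le_iff₀ Real.pi_pos]
  have := Real.arcsin_le_pi_div_two (Real.sqrt a / 2)
  linarith

/-- `|x(a)| ≤ 1/2`. [folklore] -/
theorem abs_frdAngle_le (a : ℝ) : |frdAngle a| ≤ 1 / 2 := by
  rw [abs_of_nonneg (frdAngle_nonneg a)]; exact frdAngle_le_half a

/-- `x(a) ≠ 0` when `0 < a ≤ 4`. [folklore] -/
theorem frdAngle_ne_zero {a : ℝ} (ha0 : 0 < a) (ha4 : a ≤ 4) : frdAngle a ≠ 0 := by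
  intro h
  have := four_mul_sin_sq_frdAngle ha0.le ha4
  rw [h, mul_zero, Real.sin_zero] at this
  linarith

/-- Jordan's inequality in the form `a ≤ 4π² x(a)²` (`sin(πx) ≤ πx`). [folklore] -/
theorem le_four_pi_sq_mul_frdAngle_sq {a : ℝ} (ha0 : 0 ≤ a) (ha4 : a ≤ 4) :
    a ≤ 4 * π ^ 2 * frdAngle a ^ 2 := by
  have h := four_mul_sin_sq_frdAngle ha0 ha4
  have hx := frdAngle_nonneg a
  have hs : Real.sin (π * frdAngle a) ≤ π * frdAngle a := Real.sin_le (by positivity)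
  have hs0 : 0 ≤ Real.sin (π * frdAngle a) := by
    have h1 : π * frdAngle a ≤ π / 2 := by
      have := frdAngle_le_half a; nlinarith [Real.pi_pos]
    exact Real.sin_nonneg_of_nonneg_of_le_pi (by positivity) (by linarith [Real.pi_pos])
  calc a = 4 * Real.sin (π * frdAngle a) ^ 2 := h.symm
    _ ≤ 4 * (π * frdAngle a) ^ 2 := by gcongr
    _ = 4 * π ^ 2 * frdAngle a ^ 2 := by ring

/-! ## Symbols of the pieces -/

omit [Fintype G] [DecidableEq G] in
/-- `p(c)` computed in `ℂ` is `p(c)` computed in `ℝ`. [folklore] -/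
private theorem aeval_ofReal (c : ℝ) (p : ℝ[X]) :
    Polynomial.aeval (c : ℂ) p = ((p.eval c : ℝ) : ℂ) := by
  rw [← Complex.coe_algebraMap, Polynomial.aeval_algebraMap_apply_eq_algebraMap_eval]

/-- The symbol of `A` at `ψ` lies in `[0, 4]` when `0 ≤ A ≤ 4` (translation-invariant symmetric `A`).
[folklore] -/
theorem symbol_re_mem_Icc (hA : IsTranslationInvariant A) (h0 : A.PosSemidef)
    (h4 : ((4 : ℝ) • (1 : _root_.Matrix G G ℝ) - A).PosSemidef) :
    (symbol A ψ).re ∈ Set.Icc (0 : ℝ) 4 := by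
  refine ⟨symbol_re_nonneg ψ hA h0, ?_⟩
  have h := symbol_re_mono ψ hA (IsTranslationInvariant.one.smul 4) h4
  rwa [symbol_smul, symbol_one, mul_one, Complex.ofReal_re] at h

/-- The symbol of `B = 1 − A/2` is `cos(2π x(a))`, `a = σ_A(ψ)`. [folklore] -/
theorem symbol_frdCos (hA : IsTranslationInvariant A) (hs : A.IsHermitian) (h0 : A.PosSemidef)
    (h4 : ((4 : ℝ) • (1 : _root_.Matrix G G ℝ) - A).PosSemidef) :
    symbol (frdCos A) ψ = (Real.cos (2 * π * frdAngle (symbol A ψ).re) : ℂ) := by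
  have hmem := symbol_re_mem_Icc ψ hA h0 h4
  rw [cos_two_pi_frdAngle hmem.1 hmem.2]
  unfold frdCos
  rw [symbol_sub, symbol_smul, symbol_one]
  have hre : symbol A ψ = ((symbol A ψ).re : ℂ) := by
    apply Complex.ext
    · simp
    · simp [symbol_im ψ hA hs]
  rw [hre]
  simp only [Complex.ofReal_re]
  push_cast
  ring

/-- **Symbol of the `N`-th piece**: `σ_{C_N}(ψ) = ¼ F_{2^N−1}(x(a))²`, `a = σ_A(ψ)`.
[cite: Bauerschmidt2013, Thm. 1.2 (ii) (form)] -/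
theorem symbol_frdPiece (hA : IsTranslationInvariant A) (hs : A.IsHermitian) (h0 : A.PosSemidef)
    (h4 : ((4 : ℝ) • (1 : _root_.Matrix G G ℝ) - A).PosSemidef) (N : ℕ) :
    symbol (frdPiece A N) ψ = ((1 / 4 * fejer (2 ^ N - 1) (frdAngle (symbol A ψ).re) ^ 2 : ℝ) : ℂ) := by
  unfold frdPiece
  have hB : IsTranslationInvariant (frdCos A) := IsTranslationInvariant.one.sub (hA.smul _)
  rw [symbol_smul, sq, symbol_mul ψ _ (hB.aeval _), symbol_aeval ψ hB, symbol_frdCos ψ hA hs h0 h4,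
    aeval_ofReal, fejerPoly_eval_cos]
  push_cast
  ring

/-- **Symbol of the remainder**: `σ_{R_J}(ψ) = F_{2^J−1}(x(a))/2^J`, `a = σ_A(ψ)`.
[cite: Bauerschmidt2013, Thm. 1.2 (ii) (form)] -/
theorem symbol_frdRemainder (hA : IsTranslationInvariant A) (hs : A.IsHermitian) (h0 : A.PosSemidef)
    (h4 : ((4 : ℝ) • (1 : _root_.Matrix G G ℝ) - A).PosSemidef) (J : ℕ) :
    symbol (frdRemainder A J) ψ = ((fejer (2 ^ J - 1) (frdAngle (symbol A ψ).re) / 2 ^ J : ℝ) : ℂ) := by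
  unfold frdRemainder
  have hB : IsTranslationInvariant (frdCos A) := IsTranslationInvariant.one.sub (hA.smul _)
  rw [symbol_smul, symbol_aeval ψ hB, symbol_frdCos ψ hA hs h0 h4, aeval_ofReal, fejerPoly_eval_cos]
  push_cast
  ring

/-! ## Single-shell bounds on the symbols -/

section Bounds

variable (hA : IsTranslationInvariant A) (hs : A.IsHermitian) (h0 : A.PosSemidef)
  (h4 : ((4 : ℝ) • (1 : _root_.Matrix G G ℝ) - A).PosSemidef)
include hA hs h0 h4

/-- `0 ≤ σ_{C_N}(ψ)`. [folklore] -/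
theorem symbol_frdPiece_re_nonneg (N : ℕ) : 0 ≤ (symbol (frdPiece A N) ψ).re := by
  rw [symbol_frdPiece ψ hA hs h0 h4 N, Complex.ofReal_re]
  positivity

/-- `σ_{C_N}(ψ) ≤ 4^N/4` (the ultraviolet bound: `F ≤ 2^N`). [folklore] -/
theorem symbol_frdPiece_re_le (N : ℕ) : (symbol (frdPiece A N) ψ).re ≤ 4 ^ N / 4 := by
  rw [symbol_frdPiece ψ hA hs h0 h4 N, Complex.ofReal_re]
  have := fejer_sq_dyadic_le N (frdAngle (symbol A ψ).re)
  linarith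

/-- **Infrared bound**: `σ_{C_N}(ψ) · a² ≤ π⁴/4^{N+1}`, `a = σ_A(ψ)` — the piece `C_N` lives on the
momentum shell `a ∼ 4^{−N}`. [folklore] -/
theorem symbol_frdPiece_re_mul_sq_le (N : ℕ) :
    (symbol (frdPiece A N) ψ).re * (symbol A ψ).re ^ 2 ≤ π ^ 4 / 4 ^ (N + 1) := by
  have hmem := symbol_re_mem_Icc ψ hA h0 h4
  set a := (symbol A ψ).re with ha
  rw [symbol_frdPiece ψ hA hs h0 h4 N, Complex.ofReal_re]
  rcases eq_or_lt_of_le hmem.1 with h | hpos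
  · rw [← h]; simp; positivity
  have hx0 := frdAngle_ne_zero hpos hmem.2
  have hF := fejer_sq_dyadic_le_inv N hx0 (abs_frdAngle_le _)
  have hJ := le_four_pi_sq_mul_frdAngle_sq hmem.1 hmem.2
  have hx4 : 0 < frdAngle a ^ 4 := by positivity
  -- `¼F² a² ≤ ¼ · (4π²x²)²/(16·4^N x⁴) = π⁴/4^{N+1}`
  calc 1 / 4 * fejer (2 ^ N - 1) (frdAngle a) ^ 2 * a ^ 2
      ≤ 1 / 4 * (1 / (16 * 4 ^ N * frdAngle a ^ 4)) * (4 * π ^ 2 * frdAngle a ^ 2) ^ 2 := by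
        gcongr
    _ = π ^ 4 / 4 ^ (N + 1) := by
        field_simp
        ring

/-- `0 ≤ σ_{R_J}(ψ)`. [folklore] -/
theorem symbol_frdRemainder_re_nonneg (J : ℕ) : 0 ≤ (symbol (frdRemainder A J) ψ).re := by
  rw [symbol_frdRemainder ψ hA hs h0 h4 J, Complex.ofReal_re]
  exact fejer_two_pow_div_nonneg J _

/-- `σ_{R_J}(ψ) ≤ 1`. [folklore] -/
theorem symbol_frdRemainder_re_le_one (J : ℕ) : (symbol (frdRemainder A J) ψ).re ≤ 1 := by
  rw [symbol_frdRemainder ψ hA hs h0 h4 J, Complex.ofReal_re]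
  exact fejer_two_pow_div_le_one J _

/-- **Infrared bound for the remainder**: `σ_{R_J}(ψ) · a ≤ π²/4^J`. [folklore] -/
theorem symbol_frdRemainder_re_mul_le (J : ℕ) :
    (symbol (frdRemainder A J) ψ).re * (symbol A ψ).re ≤ π ^ 2 / 4 ^ J := by
  have hmem := symbol_re_mem_Icc ψ hA h0 h4
  set a := (symbol A ψ).re with ha
  rw [symbol_frdRemainder ψ hA hs h0 h4 J, Complex.ofReal_re]
  rcases eq_or_lt_of_le hmem.1 with h | hpos
  · rw [← h]; simp; positivity
  have hx0 := frdAngle_ne_zero hpos hmem.2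
  have hF := fejer_two_pow_div_le_inv J hx0 (abs_frdAngle_le _)
  have hJ := le_four_pi_sq_mul_frdAngle_sq hmem.1 hmem.2
  have hx2 : 0 < frdAngle a ^ 2 := by positivity
  calc fejer (2 ^ J - 1) (frdAngle a) / 2 ^ J * a
      ≤ 1 / (4 * 4 ^ J * frdAngle a ^ 2) * (4 * π ^ 2 * frdAngle a ^ 2) := by
        gcongr
    _ = π ^ 2 / 4 ^ J := by
        field_simp

/-! ## Kernel bounds -/

omit h0 h4 in
/-- **Kernel bound for the pieces**: `|C_N(x,y)| ≤ |G|⁻¹ Σ_ψ σ_{C_N}(ψ)`.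
[cite: BrydgesGuadagniMitter2004, Thm. 1.1 (form of the bound)] -/
theorem abs_frdPiece_apply_le (N : ℕ) (x y : G) :
    |frdPiece A N x y| ≤ (Fintype.card G : ℝ)⁻¹ * ∑ φ : AddChar G ℂ, (symbol (frdPiece A N) φ).re :=
  abs_apply_le_avg_symbol ((IsTranslationInvariant.one.sub (hA.smul _)).aeval _ |>.pow 2 |>.smul _)
    (posSemidef_frdPiece hs N) x y

/-- The trivial (ultraviolet) kernel bound `|C_N(x,y)| ≤ 4^N/4`. [folklore] -/
theorem abs_frdPiece_apply_le_pow (N : ℕ) (x y : G) : |frdPiece A N x y| ≤ 4 ^ N / 4 := by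
  refine (abs_frdPiece_apply_le hA hs N x y).trans ?_
  have hc : (0 : ℝ) < Fintype.card G := Nat.cast_pos.mpr Fintype.card_pos
  calc (Fintype.card G : ℝ)⁻¹ * ∑ φ : AddChar G ℂ, (symbol (frdPiece A N) φ).re
      ≤ (Fintype.card G : ℝ)⁻¹ * ∑ _φ : AddChar G ℂ, (4 : ℝ) ^ N / 4 := by
        gcongr with φ
        exact symbol_frdPiece_re_le φ hA hs h0 h4 N
    _ = 4 ^ N / 4 := by
        rw [Finset.sum_const, Finset.card_univ, AddChar.card_eq, nsmul_eq_mul]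
        field_simp

omit h0 in
/-- **Kernel bound for the remainder**: `|R_J(x,y)| ≤ |G|⁻¹ Σ_ψ σ_{R_J}(ψ) ≤ 1`.
[cite: BrydgesGuadagniMitter2004, Thm. 1.1 (form of the bound)] -/
theorem abs_frdRemainder_apply_le (J : ℕ) (x y : G) :
    |frdRemainder A J x y|
      ≤ (Fintype.card G : ℝ)⁻¹ * ∑ φ : AddChar G ℂ, (symbol (frdRemainder A J) φ).re :=
  abs_apply_le_avg_symbol ((IsTranslationInvariant.one.sub (hA.smul _)).aeval _ |>.smul _)
    (posSemidef_frdRemainder hs h4 J) x y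

end Bounds

end Literature.Analysis.Matrix

end
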